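import Literature.AlgebraicGeometry.KTheory.CoherentGrothendieckGroupRankLocallyFree
import Literature.AlgebraicGeometry.KTheory.GrothendieckGroupProduct
import Literature.AlgebraicGeometry.Modules.TensorStalk
import HarnessLib

/-!
# The rank homomorphism `rank : K₀(X) → ℤ` on an integral scheme; multiplicativity in `K₀(X)` and on `K(X)`

Layer `Literature/AlgebraicGeometry/KTheory` (one definition, 0 named facts, no instances, no notation). Hartshorne II
Ex. 6.10 (b) (rank `dim_K 𝓕_ξ` of a coherent sheaf on an integral scheme) restricted along
`ε : K₀(X) → K(X)` (`KTheory/CoherentGrothendieckGroup.KZero.toKZeroCoh`); Fulton, *Intersection Theory*, §15.1 /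
Example 15.1.1 (the rank homomorphism on `K⁰X`). This file types

* `finrank_genericStalk_tensorObj` — **`dim_{K(X)} (E ⊗ E′)_η = dim E_η · dim E′_η`** for ANY two `𝒪_X`-modules (the
  stalk–tensor isomorphism `Modules/TensorStalk.stalkTensorEquiv` of the tree, Stacks 01CA, and Mathlib's
  `Module.finrank_tensorProduct` over the function field);
* **`KZero.rank : KZero X →+ ℤ`**, `rank := KZeroCoh.genericRank ∘ ε` (ONE definition), with `rank_of`,
  `rank_of_hasRank` (`rank [E] = r` for a bundle of rank `r`, `KTheory/CoherentGrothendieckGroupRankLocallyFree`),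
  `rank_unit = 1`, `rank_surjective`, and **multiplicativity `rank (x · y) = rank x * rank y`** for the product
  `KZero.mulHom` of `KTheory/GrothendieckGroupProduct` (theorems; no `RingHom` is built since no ring instance is
  declared on `KZero X`);
* **`KZeroCoh.genericRank_smulHom : rank (x • w) = rank x * rank w`** for the `K₀(X)`-action on `K(X)`
  (`KTheory/CoherentGrothendieckGroupModule.smulHom`).

## References

* R. Hartshorne, *Algebraic Geometry*, GTM 52 (1977), II Ex. 6.10 (b) (p. 148). [Hartshorne1977]
* W. Fulton, *Intersection Theory*, 2nd ed. (1998), §15.1 and Example 15.1.1 (p. 281–282). [Fulton1998]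
* The Stacks Project, Tag 01CA (Lemma 17.16.1: stalks of the tensor product). [StacksProject]
-/

noncomputable section

-- `TopCat.Presheaf`/`Scheme.Modules` are not reducible (as in Mathlib's `AlgebraicGeometry/Modules`).
set_option backward.isDefEq.respectTransparency false

universe u

open CategoryTheory CategoryTheory.Limits AlgebraicGeometry TopologicalSpace Opposite
open scoped TensorProduct

namespace Literature.AlgebraicGeometry.KTheory

open Literature.AlgebraicGeometry.Motives Literature.AlgebraicGeometry.Morphisms Literature.AlgebraicGeometry.Modules
open Literature.AlgebraicGeometry.KTheory.Adapted (coh_of_isFiniteLocallyFree)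

variable {X : Scheme.{u}} [IsIntegral X]

/-- **`dim_{K(X)} (E ⊗ E′)_η = dim E_η · dim E′_η`** for any two `𝒪_X`-modules on an integral scheme: the stalk of the
tensor product is the tensor product of the stalks (`Modules/TensorStalk.stalkTensorEquiv`, Stacks 01CA) and dimensions
of vector spaces multiply (`Module.finrank_tensorProduct`). [cite: StacksProject, Tag 01CA (Lemma 17.16.1)] -/
theorem finrank_genericStalk_tensorObj (E E' : X.Modules) :
    Module.finrank X.functionField ((stalkFunctor (genericPoint X)).obj (tensorObj E E')) =
      Module.finrank X.functionField ((stalkFunctor (genericPoint X)).obj E) *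
        Module.finrank X.functionField ((stalkFunctor (genericPoint X)).obj E') := by
  rw [(stalkTensorEquiv E E' (genericPoint X)).finrank_eq, Module.finrank_tensorProduct]

namespace KZeroCoh

/-- **The rank of `[E] • [F] = [E ⊗ F]` is `dim E_η · rank [F]`** on generators of the `K₀(X)`-action on `K(X)`
(`X` integral, locally noetherian). [cite: Hartshorne1977, II Ex. 6.10 (b) (p. 148)] -/
theorem genericRank_smulHom_of_of [IsLocallyNoetherian X] {E F : X.Modules} (hE : IsFiniteLocallyFree E) (hF : Coh F) :
    genericRank (smulHom (KZero.of E hE) (KZeroCoh.of F hF)) =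
      genericRank (KZero.toKZeroCoh (KZero.of E hE)) * genericRank (KZeroCoh.of F hF) := by
  rw [smulHom_of_of hE hF (Coh.tensorObj_of_isFiniteLocallyFree hE hF), KZero.toKZeroCoh_of E hE (coh_of_isFiniteLocallyFree hE),
    genericRank_of, genericRank_of, genericRank_of, finrank_genericStalk_tensorObj, Nat.cast_mul]

/-- **`rank (x • w) = rank (ε x) · rank w`**: the generic rank is multiplicative for the `K₀(X)`-module structure on
`K(X)` (`X` integral, locally noetherian). [cite: Hartshorne1977, II Ex. 6.10 (b) (p. 148)] [cite: Fulton1998, §15.1 (p. 281)] -/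
theorem genericRank_smulHom [IsLocallyNoetherian X] (x : KZero X) (w : KZeroCoh X) :
    genericRank (smulHom x w) = genericRank (KZero.toKZeroCoh x) * genericRank w := by
  induction x using KZero.induction_on with
  | zero => simp only [map_zero, AddMonoidHom.zero_apply, zero_mul]
  | of E hE =>
    induction w using KZeroCoh.induction_on with
    | zero => simp only [map_zero, mul_zero]
    | of F hF => exact genericRank_smulHom_of_of hE hF
    | neg w hw => simp only [map_neg, hw, mul_neg]
    | add w w' hw hw' => simp only [map_add, hw, hw', mul_add]
  | neg x hx => simp only [map_neg, AddMonoidHom.neg_apply, hx, neg_mul]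
  | add x x' hx hx' => simp only [map_add, AddMonoidHom.add_apply, hx, hx', add_mul]

end KZeroCoh

namespace KZero

/-- **The rank homomorphism `rank : K₀(X) → ℤ` on an integral scheme**, `[E] ↦ dim_{K(X)} E_η`: the generic rank of
`KTheory/CoherentGrothendieckGroupRank` composed with `ε : K₀(X) → K(X)` (Fulton §15.1 / Ex. 15.1.1; Hartshorne II
Ex. 6.10 (b)). ONE definition; no `RingHom` (no ring instance on `KZero X` is declared) — multiplicativity is
`rank_mulHom`. [cite: Fulton1998, §15.1 and Example 15.1.1 (p. 281)] [cite: Hartshorne1977, II Ex. 6.10 (b) (p. 148)] -/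
def rank : KZero X →+ ℤ :=
  KZeroCoh.genericRank.comp KZero.toKZeroCoh

/-- Unfolding: `rank x = genericRank (ε x)`. [cite: Hartshorne1977, II Ex. 6.10 (b) (p. 148)] -/
theorem rank_apply (x : KZero X) : rank x = KZeroCoh.genericRank (KZero.toKZeroCoh x) := rfl

/-- **`rank [E] = dim_{K(X)} E_η`.** [cite: Hartshorne1977, II Ex. 6.10 (b) (p. 148)] -/
theorem rank_of (E : X.Modules) (hE : IsFiniteLocallyFree E) :
    rank (KZero.of E hE) = (Module.finrank X.functionField ((stalkFunctor (genericPoint X)).obj E) : ℤ) := by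
  rw [rank_apply, KZero.toKZeroCoh_of E hE (coh_of_isFiniteLocallyFree hE), KZeroCoh.genericRank_of]

/-- **`rank [E] = r` for a vector bundle of rank `r`.** [cite: Fulton1998, §15.1 and Example 15.1.1 (p. 281)] -/
theorem rank_of_hasRank {E : X.Modules} {r : ℕ} (hE : HasRank E r) :
    rank (KZero.of E hE.hasRankLE.isFiniteLocallyFree) = r :=
  KZeroCoh.genericRank_toKZeroCoh_of_eq_of_hasRank hE

/-- **`rank [𝒪_X] = 1`.** [cite: Fulton1998, §15.1 and Example 15.1.1 (p. 281)] -/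
theorem rank_unit : rank (KZero.of (unitModule X) isFiniteLocallyFree_unitModule) = 1 :=
  KZeroCoh.genericRank_toKZeroCoh_of_unitModule

/-- `rank` is non-negative on classes of vector bundles. [cite: Hartshorne1977, II Ex. 6.10 (b) (p. 148)] -/
theorem rank_of_nonneg (E : X.Modules) (hE : IsFiniteLocallyFree E) : 0 ≤ rank (KZero.of E hE) := by
  rw [rank_of]
  exact Int.natCast_nonneg _

/-- **`rank : K₀(X) → ℤ` is surjective** (`rank (n[𝒪_X]) = n`). [cite: Fulton1998, §15.1 and Example 15.1.1 (p. 281)] -/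
theorem rank_surjective : Function.Surjective (rank (X := X)) := fun n =>
  ⟨n • KZero.of (unitModule X) isFiniteLocallyFree_unitModule, by rw [map_zsmul, rank_unit, smul_eq_mul, mul_one]⟩

/-- **Multiplicativity on generators: `rank ([E] · [E′]) = rank [E] * rank [E′]`** (`(E ⊗ E′)_η ≅ E_η ⊗ E′_η`).
[cite: Fulton1998, §15.1 and Example 15.1.1 (p. 281)] [cite: StacksProject, Tag 01CA (Lemma 17.16.1)] -/
theorem rank_mulHom_of_of {E E' : X.Modules} (hE : IsFiniteLocallyFree E) (hE' : IsFiniteLocallyFree E') :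
    rank (mulHom (KZero.of E hE) (KZero.of E' hE')) = rank (KZero.of E hE) * rank (KZero.of E' hE') := by
  rw [mulHom_of_of hE hE' (isFiniteLocallyFree_tensorObj E E' hE hE'), rank_of, rank_of, rank_of,
    finrank_genericStalk_tensorObj, Nat.cast_mul]

/-- **`rank` is multiplicative: `rank (x · y) = rank x * rank y`** for the product on `K₀(X)` — with `rank_unit` and
additivity, `rank` is a ring homomorphism `K₀(X) → ℤ` in all but the (undeclared) instance.
[cite: Fulton1998, §15.1 and Example 15.1.1 (p. 281)] -/
theorem rank_mulHom (x y : KZero X) : rank (mulHom x y) = rank x * rank y := by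
  induction x using KZero.induction_on with
  | zero => simp only [map_zero, AddMonoidHom.zero_apply, zero_mul]
  | of E hE =>
    induction y using KZero.induction_on with
    | zero => simp only [map_zero, mul_zero]
    | of E' hE' => exact rank_mulHom_of_of hE hE'
    | neg y hy => simp only [map_neg, hy, mul_neg]
    | add y y' hy hy' => simp only [map_add, hy, hy', mul_add]
  | neg x hx => simp only [map_neg, AddMonoidHom.neg_apply, hx, neg_mul]
  | add x x' hx hx' => simp only [map_add, AddMonoidHom.add_apply, hx, hx', add_mul]

/-- `rank (x • w) = rank x * rank w` for the action of `K₀(X)` on `K(X)` (`X` integral, locally noetherian).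
[cite: Fulton1998, §15.1 (p. 281)] -/
theorem rank_smulHom [IsLocallyNoetherian X] (x : KZero X) (w : KZeroCoh X) :
    KZeroCoh.genericRank (KZeroCoh.smulHom x w) = rank x * KZeroCoh.genericRank w :=
  KZeroCoh.genericRank_smulHom x w

end KZero

end Literature.AlgebraicGeometry.KTheory

end
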